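import Summits.AtomisticToContinuum.HydrodynamicLimit.Theorems.DensityCap.Negative.MollifiedDensity
import Literature.Analysis.FluidPDE.HardSpherePhaseSpaceProofs
import Literature.Analysis.FluidPDE.HardSphereRegularGeometry

open Literature.MathematicalPhysics.KineticTheory Literature.Analysis.FluidPDE Set

namespace DrefuteNetProbe

example : CompactSpace T3 := inferInstance

/-- Finite `euclidDist`-nets of `T3` exist at every mesh (what STUB E needs for `Sx`). -/
theorem exists_euclidDist_net {δ : ℝ} (hδ : 0 < δ) :
    ∃ Sx : Finset T3, ∀ x : T3, ∃ x' ∈ Sx, Torus.euclidDist x x' ≤ δ := by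
  have h3 : (0 : ℝ) < Real.sqrt 3 := Real.sqrt_pos.2 (by norm_num)
  obtain ⟨S, -, hSfin, hcover⟩ :=
    finite_cover_balls_of_compact (isCompact_univ (X := T3)) (e := δ / Real.sqrt 3) (by positivity)
  refine ⟨hSfin.toFinset, fun x => ?_⟩
  obtain ⟨x', hx', hxx'⟩ := Set.mem_iUnion₂.1 (hcover (Set.mem_univ x))
  refine ⟨x', hSfin.mem_toFinset.2 hx', ?_⟩
  have hle := Torus.euclidDist_le_holds x x'
  rw [Fintype.card_fin] at hle
  have hd : ‖x - x'‖ < δ / Real.sqrt 3 := by rwa [Metric.mem_ball, dist_eq_norm] at hxx'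
  calc Torus.euclidDist x x' ≤ Real.sqrt (3 : ℕ) * ‖x - x'‖ := hle
    _ ≤ Real.sqrt 3 * (δ / Real.sqrt 3) := by
        push_cast
        exact mul_le_mul_of_nonneg_left hd.le h3.le
    _ = δ := by field_simp

/-- Finite time nets of `[0, t]` inside `[0, t]` (what STUB E needs for `St`; uses `0 ≤ t`). -/
theorem exists_time_net {t δ : ℝ} (ht : 0 ≤ t) (hδ : 0 < δ) :
    ∃ St : Finset ℝ, (∀ s ∈ St, s ∈ Icc 0 t) ∧ ∀ s ∈ Icc 0 t, ∃ s' ∈ St, |s - s'| ≤ δ := by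
  obtain ⟨M, hM⟩ := exists_nat_gt (t / δ)
  have hMpos : (0 : ℝ) < M := lt_of_le_of_lt (div_nonneg ht hδ.le) hM
  have hstep : t / M ≤ δ := by
    rw [div_le_iff₀ hMpos]
    have := (div_lt_iff₀ hδ).1 hM
    linarith
  refine ⟨(Finset.range (M + 1)).image fun k : ℕ => (k : ℝ) * (t / M), ?_, ?_⟩
  · intro s hs
    obtain ⟨k, hk, rfl⟩ := Finset.mem_image.1 hs
    have hkM : (k : ℝ) ≤ M := by exact_mod_cast Nat.lt_succ_iff.1 (Finset.mem_range.1 hk)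
    refine ⟨by positivity, ?_⟩
    calc (k : ℝ) * (t / M) ≤ M * (t / M) := by gcongr
      _ = t := by field_simp
  · intro s hs
    -- k := ⌊s / (t/M)⌋ when t > 0; if t = 0 then s = 0 and k = 0 works
    rcases eq_or_lt_of_le ht with rfl | htpos
    · refine ⟨0, Finset.mem_image.2 ⟨0, by simp, by simp⟩, ?_⟩
      have : s = 0 := le_antisymm hs.2 hs.1
      simp [this, hδ.le]
    · have hh : 0 < t / M := div_pos htpos hMpos
      set k := ⌊s / (t / M)⌋₊ with hk
      have hks : (k : ℝ) * (t / M) ≤ s := by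
        have := Nat.floor_le (div_nonneg hs.1 hh.le)
        rw [← hk] at this
        calc (k : ℝ) * (t / M) ≤ s / (t / M) * (t / M) := by gcongr
          _ = s := by field_simp
      have hsk : s < ((k : ℝ) + 1) * (t / M) := by
        have := Nat.lt_floor_add_one (s / (t / M))
        rw [← hk] at this
        calc s = s / (t / M) * (t / M) := by field_simp
          _ < ((k : ℝ) + 1) * (t / M) := by gcongr
      have hkM : k ≤ M := by
        have h1 : (k : ℝ) * (t / M) ≤ t := hks.trans hs.2
        have h2 : (k : ℝ) ≤ M := by
          by_contra hlt
          rw [not_le] at hlt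
          have : (M : ℝ) * (t / M) < k * (t / M) := by gcongr
          rw [show (M : ℝ) * (t / M) = t by field_simp] at this
          linarith
        exact_mod_cast h2
      refine ⟨(k : ℝ) * (t / M), Finset.mem_image.2 ⟨k, Finset.mem_range.2 (Nat.lt_succ_of_le hkM), rfl⟩, ?_⟩
      rw [abs_of_nonneg (by linarith)]
      calc s - k * (t / M) ≤ t / M := by nlinarith
        _ ≤ δ := hstep

end DrefuteNetProbe
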